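import Summits.QuantumFields.GaugeBoot.DiagonalRPTorusTwoZigzag
import Summits.QuantumFields.GaugeBoot.DiagonalRPTorusTwoGram
import HarnessLib

/-!
# Diagonal RP HOLDS on the two-dimensional even torus for gauge-invariant observables
(gauge-boot, task L3(ε))

HONEST FRAMING (cell `pub-gaugeboot`, page 1 of every file): the venture produces certified bounds
on lattice expectations at stated coupling, gauge group, dimension and torus size; NOT a mass gap,
NOT a continuum limit, NOT a string tension; NOT Yang–Mills-summit-bearing (barriers
`FixedCouplingUltralocality`, `PerturbativeInvisibility`). This module is a small POSITIVE
structural result about which positivity constraints a two-dimensional TORUS certificate may use;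
it discharges nothing else.

`DiagonalRPTorusNegativeTwo.lean` (L3(δ)) shows that closed-half-space diagonal reflection
positivity `DiagonalReflectionPositive ρ β i j` FAILS on the square torus `(ℤ/L)²` (`L ≥ 4` even,
`β ≠ 0`) — with a gauge-VARIANT witness (a function of the open transports `D_y`). Certificates
only use gauge-invariant observables (Wilson loops). In the gauge-invariant sector it HOLDS:

* `GaugeInvariantDiagonalRP ρ β i j` — the statement `DiagonalReflectionPositive ρ β i j`
  restricted to GAUGE-INVARIANT closed-half observables (`IsGaugeInvariant`, tree vocabulary);
  `DiagonalReflectionPositive.gaugeInvariantDiagonalRP` (the restriction is weaker);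
* **`DiagRPTwo.wilsonExpectation_swap_nonneg_of_isGaugeInvariant`** — on `(ℤ/L)²`, `L ≥ 6`
  even, every `β ≥ 0`, compact metrisable `G`, continuous `ρ`: `0 ≤ ⟨(ΘF)‾ F⟩_{Λ,β}` for every
  bounded measurable gauge-invariant observable `F` of the closed diagonal half;
* **`DiagRPTwo.gaugeInvariantDiagonalRP_two`** — hence `GaugeInvariantDiagonalRP ρ β i j`.

So in `d = 2` the torus obstruction of L3(δ) is PURELY GAUGE-VARIANT: for gauge-invariant closed-half
observables swap-RP holds on `(ℤ/L)²`, `L ≥ 6` even, at every `β ≥ 0`. This resolves pub-gaugeboot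
LOOP-SDP.md §3.4(ii) positively in `d = 2` (the gauge-invariant closed half contains the Wilson
lines of `0 ≤ k ≤ m < L/2`); §3.4(i) is the gauge-variant failure of L3(δ); `d ≥ 3` is untouched.

## What is NOT claimed

* `L = 4` (the proof integrates one bond layer between the mirror side and the back zigzag and
  uses `c ≠ -2`); `β < 0`; odd `L`.
* Nothing in `d ≥ 3`: there the closed-half statement FAILS gauge-invariantly as well (a Polyakov
  line of a third direction inside the back layer minus its `τ`-translate is an odd gauge-invariant
  witness), §3.4(ii) for Wilson lines strictly inside the half stays open there, and the Class-A
  block list (Gram, site-RP, link-RP) of every `D = 3, 4` certificate of record is unchanged. This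
  is a structural lemma about which blocks a 2D TORUS certificate may use, not a certificate.

## Proof

Notation (`DiagonalRPTorusTwoTwist.lean`): `k = y_i - y_j`, `c = L/2`, `τ` = translation by
`c(e_i + e_j)`, `T̂` = relabel the links touching the back layer by `τ`, `Θ' = T̂ ∘ Θ`.
(1) `DiagonalRPTorusTwoGram.lean`: `Z⟨(ΘF)‾F⟩ = e^{-βN#P} ∫ g(U) conj g(ΘU) E(U) dU`,
`g = F e^{β S_int}`, `E = exp(β(Σ_{k=0} r_y + Σ_{k=c} r_y)) = exp(Σ_ι a_ι(U) conj a_ι(Θ'U))`, and the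
abstract Osterwalder–Seiler lemma gives `0 ≤ ∫ g(U) conj g(Θ'U) E(U) dU`. (2)
`DiagonalRPTorusTwoZigzag.lean`: for gauge-invariant `F`, `g(T̂Y) = g(Ψ₁Y)` with `Ψ₁` a
Haar-preserving field-dependent gauge correction — the half-turn of the back zigzag is a gauge
transformation. (3) Here: `g(Θ'U) = g(Ψ₁ΘU) = g(ΘΨ₂U)`, `Ψ₂ = ΘΨ₁Θ` Haar-preserving and fixing
`g(U)`, `E(U)` (`L ≥ 6`), so `∫ g conj(g∘Θ') E = ∫ (g conj(g∘Θ) E) ∘ Ψ₂ = ∫ g conj(g∘Θ) E ≥ 0`.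

References: Osterwalder–Seiler, Ann. Phys. 110 (1978) 440, §2; Seiler, LNP 159 (1982) Ch. 2;
Kazakov–Zheng, arXiv:2203.11360 §3.1. The statement itself is, as far as we searched, not in print
(printed remark for spin systems: FILS, J. Stat. Phys. 22 (1980) 297, §3; Biskup, LNM 1970 (2009) §5.5). -/

open MeasureTheory Complex Finset Function
open scoped ComplexOrder ENNReal

namespace Summit.QuantumFields.GaugeBoot

open Literature.MathematicalPhysics.QuantumFieldTheory
open Literature.RepresentationTheory.CompactGroups

noncomputable section

section Statement

variable {d L N : ℕ} [NeZero L] {G : Type*} [Group G] [TopologicalSpace G] [IsTopologicalGroup G]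
  [CompactSpace G] [MeasurableSpace G] [BorelSpace G] (ρ : G →* Matrix (Fin N) (Fin N) ℂ)

/-- **Closed-half-space diagonal reflection positivity on the torus, GAUGE-INVARIANT SECTOR**:
`0 ≤ ⟨(ΘF)‾ F⟩_{Λ,β}` (real and non-negative in `Complex.partialOrder`) for every bounded
measurable GAUGE-INVARIANT observable `F` of the closed diagonal half
`{0 ≤ (y_i - y_j) mod L ≤ L/2}`, `Θ = configDiagSwap i j` — the statement
`DiagonalReflectionPositive ρ β i j` restricted to `IsGaugeInvariant F` (the only observables a
certificate uses). [shape] A parametric definition of a proposition — NOT a fact. [folklore] -/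
def GaugeInvariantDiagonalRP (β : ℝ) (i j : Fin d) : Prop :=
  ∀ (F : GaugeConfig d L G → ℂ), Measurable F → (∃ C : ℝ, ∀ U, ‖F U‖ ≤ C) →
    IsDiagonalHalfObservable i j F → IsGaugeInvariant F →
      0 ≤ wilsonExpectation ρ β fun U => (starRingEnd ℂ) (F (configDiagSwap i j U)) * F U

/-- The gauge-invariant statement is a weakening of the full one. -/
theorem DiagonalReflectionPositive.gaugeInvariantDiagonalRP {β : ℝ} {i j : Fin d}
    (h : DiagonalReflectionPositive (d := d) (L := L) ρ β i j) :
    GaugeInvariantDiagonalRP (d := d) (L := L) ρ β i j :=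
  fun F hF hFb hFH _ => h F hF hFb hFH

end Statement

namespace DiagRPTwo

section Gauge

variable {L N : ℕ} {G : Type*} [Group G] (ρ : G →* Matrix (Fin N) (Fin N) ℂ)

/-- The plaquette term `r_y` is gauge invariant. -/
theorem rr_gaugeTransform (i j : Fin 2) (g : Site 2 L → G) (U : GaugeConfig 2 L G) (y : Site 2 L) :
    rr ρ i j (gaugeTransform g U) y = rr ρ i j U y := by
  have hcomm : (y.shift j).shift i = (y.shift i).shift j := WilsonRP.shift_comm y j i
  have h : cT i j (gaugeTransform g U) y * (dT i j (gaugeTransform g U) y)⁻¹ =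
      g y * (cT i j U y * (dT i j U y)⁻¹) * (g y)⁻¹ := by
    simp only [cT, dT, gaugeTransform, hcomm, mul_inv_rev, inv_inv]
    group
  rw [rr, rr, h, CompactGroup.trace_conj_eq]

variable [NeZero L] [TopologicalSpace G] [IsTopologicalGroup G] [CompactSpace G]

omit [TopologicalSpace G] [IsTopologicalGroup G] [CompactSpace G] in
/-- `g = F e^{β S_int}` is gauge invariant when `F` is. -/
theorem gObs_gaugeTransform (i j : Fin 2) (β : ℝ) {F : GaugeConfig 2 L G → ℂ} (hFg : IsGaugeInvariant F)
    (g : Site 2 L → G) (U : GaugeConfig 2 L G) :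
    gObs ρ i j β F (gaugeTransform g U) = gObs ρ i j β F U := by
  simp only [gObs, hFg g U, rr_gaugeTransform]

omit [TopologicalSpace G] [IsTopologicalGroup G] [CompactSpace G] in
/-- **The twist is invisible to `g`**: `g(T̂Y) = g(Ψ₁Y)` for gauge-invariant `F` (`L ≥ 4`). -/
theorem gObs_configTau (h4 : 4 ≤ L) {i j : Fin 2} (hij : i ≠ j) (β : ℝ) {F : GaugeConfig 2 L G → ℂ}
    (hFH : IsDiagonalHalfObservable i j F) (hFg : IsGaugeInvariant F) (Y : GaugeConfig 2 L G) :
    gObs ρ i j β F (configTau i j Y) = gObs ρ i j β F (untwist i j Y) := by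
  rw [← gObs_gaugeTransform ρ i j β hFg (hfun i j Y) (untwist i j Y)]
  exact dependsOn_gObs ρ h4 hij β hFH fun e he =>
    (gaugeTransform_untwist_of_inHalf h4 hij Y (mem_halfLinks.1 (Finset.mem_coe.1 he))).symm

end Gauge

/-! ## `Ψ₂ = Θ Ψ₁ Θ` and what it fixes -/

section Psi

variable {L : ℕ} (i j : Fin 2) {G : Type*} [Group G]

/-- `Ψ₂ = Θ ∘ Ψ₁ ∘ Θ`. -/
def untwist' (X : GaugeConfig 2 L G) : GaugeConfig 2 L G :=
  configDiagSwap i j (untwist i j (configDiagSwap i j X))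

variable {i j}

/-- `Θ ∘ Ψ₂ = Ψ₁ ∘ Θ`. -/
theorem configDiagSwap_untwist' (X : GaugeConfig 2 L G) :
    configDiagSwap i j (untwist' i j X) = untwist i j (configDiagSwap i j X) := by
  rw [untwist', configDiagSwap_configDiagSwap]

/-- A residue off the back layer and off the layer `c + 1` has its negative off the layers `c - 1`,
`c` (even `L`). -/
theorem neg_ne_layers (hL : Even L) {k : ZMod L} (h1 : k ≠ cc L) (h2 : k ≠ cc L + 1) :
    -k ≠ cc L - 1 ∧ -k ≠ cc L := by
  constructor
  · intro h
    apply h2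
    have : k = -(cc L - 1) := by rw [← h, neg_neg]
    rw [this, neg_sub, sub_eq_add_neg, neg_cc hL, add_comm]
  · intro h
    apply h1
    have : k = -cc L := by rw [← h, neg_neg]
    rw [this, neg_cc hL]

/-- `Ψ₂` fixes the links touching the back layer (even `L`). -/
theorem untwist'_apply_of_tw (hL : Even L) (X : GaugeConfig 2 L G) {e : Edge 2 L} (he : TW i j e) :
    untwist' i j X e = X e := by
  have he' : TW i j (edgeDiagSwap i j e) := (tw_edgeDiagSwap_iff hL e).2 he
  simp only [untwist', configDiagSwap, untwist_apply_of_tw _ he', edgeDiagSwap_edgeDiagSwap]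

/-- `Ψ₂` fixes every link whose endpoints are off the layers `c` and `c + 1` (even `L`). -/
theorem untwist'_apply_of_ne (hL : Even L) (X : GaugeConfig 2 L G) {e : Edge 2 L}
    (h1 : kd i j e.1 ≠ cc L) (h2 : kd i j e.1 ≠ cc L + 1) (h3 : kd i j (e.1.shift e.2) ≠ cc L)
    (h4 : kd i j (e.1.shift e.2) ≠ cc L + 1) : untwist' i j X e = X e := by
  obtain ⟨y, μ⟩ := e
  obtain ⟨ha, hb⟩ := neg_ne_layers hL h1 h2
  obtain ⟨hc, hd⟩ := neg_ne_layers hL h3 h4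
  have e2 : (siteDiagSwap i j y).shift (Equiv.swap i j μ) = siteDiagSwap i j (y.shift μ) :=
    (siteDiagSwap_shift i j y μ).symm
  have key : untwist i j (configDiagSwap i j X) (edgeDiagSwap i j (y, μ)) =
      configDiagSwap i j X (edgeDiagSwap i j (y, μ)) := by
    refine untwist_apply_of_far _ ?_ ?_ ?_ ?_
    · simpa only [edgeDiagSwap, kd_siteDiagSwap] using ha
    · simpa only [edgeDiagSwap, kd_siteDiagSwap] using hb
    · simpa only [edgeDiagSwap, e2, kd_siteDiagSwap] using hc
    · simpa only [edgeDiagSwap, e2, kd_siteDiagSwap] using hd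
  calc untwist' i j X (y, μ) = untwist i j (configDiagSwap i j X) (edgeDiagSwap i j (y, μ)) := rfl
    _ = configDiagSwap i j X (edgeDiagSwap i j (y, μ)) := key
    _ = X (y, μ) := by simp only [configDiagSwap, edgeDiagSwap_edgeDiagSwap]

/-- `(c + 1).val = L/2 + 1` (`L ≥ 4`). -/
theorem val_cc_add_one (h4 : 4 ≤ L) : (cc L + 1).val = L / 2 + 1 := by
  rw [ZMod.val_add_of_lt, cc_val h4, val_one_of_four_le h4]
  rw [cc_val h4, val_one_of_four_le h4]; omega

/-- `Ψ₂` fixes the links of the closed half (`L ≥ 4` even). -/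
theorem untwist'_apply_of_inHalf (hL : Even L) (h4 : 4 ≤ L) (X : GaugeConfig 2 L G) {e : Edge 2 L}
    (he : InHalf i j e) : untwist' i j X e = X e := by
  by_cases ht : TW i j e
  · exact untwist'_apply_of_tw hL X ht
  · have hv := val_cc_add_one (L := L) h4
    simp only [TW, not_or] at ht
    refine untwist'_apply_of_ne hL X ht.1 (fun h => ?_) ht.2 (fun h => ?_)
    · have := he.1; rw [h, hv] at this; omega
    · have := he.2; rw [h, hv] at this; omega

variable [NeZero L]

/-- `Ψ₂` fixes the links of the mirror plaquettes (`L ≥ 6` even: this is where `L = 4` fails). -/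
theorem untwist'_apply_of_mem_blk_S0 (hL : Even L) (h6 : 6 ≤ L) {i j : Fin 2} (hij : i ≠ j)
    (X : GaugeConfig 2 L G) {y : Site 2 L} (hy : y ∈ S0 i j) {e : Edge 2 L} (he : e ∈ blk i j y) :
    untwist' i j X e = X e := by
  have h4 : 4 ≤ L := by omega
  have hk : kd i j y = 0 := (kd_eq_zero_iff y).2 (mem_S0.1 hy)
  have hv := val_cc_add_one (L := L) h4
  have h1v := val_one_of_four_le h4
  have hc2 : (cc L + 1 + 1).val = L / 2 + 2 := by
    rw [ZMod.val_add_of_lt, hv, h1v]; rw [hv, h1v]; omega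
  -- the four residues occurring as endpoints: `0`, `1`, `-1`
  have h0c : (0 : ZMod L) ≠ cc L := fun h => cc_ne_zero h4 h.symm
  have h0c1 : (0 : ZMod L) ≠ cc L + 1 := fun h => by
    have := congrArg ZMod.val h; rw [ZMod.val_zero, hv] at this; omega
  have h1c : (1 : ZMod L) ≠ cc L := fun h => cc_ne_one h4 h.symm
  have h1c1 : (1 : ZMod L) ≠ cc L + 1 := fun h => by
    have := congrArg ZMod.val h; rw [h1v, hv] at this; omega
  have hm1c : (-1 : ZMod L) ≠ cc L := fun h => cc_ne_neg_one h4 h.symm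
  have hm1c1 : (-1 : ZMod L) ≠ cc L + 1 := fun h => by
    have h' : cc L + 1 + 1 = 0 := by rw [← h, neg_add_cancel]
    have := congrArg ZMod.val h'; rw [hc2, ZMod.val_zero] at this; omega
  have hki : kd i j (y.shift i) = 1 := by rw [kd_shift_left hij, hk, zero_add]
  have hkj : kd i j (y.shift j) = -1 := by rw [kd_shift_right hij, hk, zero_sub]
  have hkij : kd i j ((y.shift i).shift j) = 0 := by rw [kd_shift_right hij, hki, sub_self]
  have hkji : kd i j ((y.shift j).shift i) = 0 := by rw [kd_shift_left hij, hkj, neg_add_cancel]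
  rw [mem_blk] at he
  rcases he with rfl | rfl | rfl | rfl
  · exact untwist'_apply_of_ne hL X (by rw [hk]; exact h0c) (by rw [hk]; exact h0c1)
      (by rw [hki]; exact h1c) (by rw [hki]; exact h1c1)
  · exact untwist'_apply_of_ne hL X (by rw [hki]; exact h1c) (by rw [hki]; exact h1c1)
      (by rw [hkij]; exact h0c) (by rw [hkij]; exact h0c1)
  · exact untwist'_apply_of_ne hL X (by rw [hk]; exact h0c) (by rw [hk]; exact h0c1)
      (by rw [hkj]; exact hm1c) (by rw [hkj]; exact hm1c1)
  · exact untwist'_apply_of_ne hL X (by rw [hkj]; exact hm1c) (by rw [hkj]; exact hm1c1)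
      (by rw [hkji]; exact h0c) (by rw [hkji]; exact h0c1)

/-- `Ψ₂` fixes the links of the back-layer plaquettes (they all touch the back layer). -/
theorem untwist'_apply_of_mem_blk_Sc (hL : Even L) (h4 : 4 ≤ L) {i j : Fin 2} (hij : i ≠ j)
    (X : GaugeConfig 2 L G) {y : Site 2 L} (hy : y ∈ Sc i j) {e : Edge 2 L} (he : e ∈ blk i j y) :
    untwist' i j X e = X e := by
  have hk : kd i j y = cc L := (kd_eq_cc_iff h4 y).2 (mem_Sc.1 hy)
  have hkij : kd i j ((y.shift i).shift j) = cc L := by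
    rw [kd_shift_right hij, kd_shift_left hij, hk]; ring
  have hkji : kd i j ((y.shift j).shift i) = cc L := by
    rw [kd_shift_left hij, kd_shift_right hij, hk]; ring
  rw [mem_blk] at he
  rcases he with rfl | rfl | rfl | rfl
  · exact untwist'_apply_of_tw hL X (Or.inl hk)
  · exact untwist'_apply_of_tw hL X (Or.inr hkij)
  · exact untwist'_apply_of_tw hL X (Or.inl hk)
  · exact untwist'_apply_of_tw hL X (Or.inr hkji)

end Psi

/-! ## Assembly -/

section Main

variable {L N : ℕ} [NeZero L] {G : Type*} [Group G] [TopologicalSpace G] [IsTopologicalGroup G]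
  [CompactSpace G] [MeasurableSpace G] [BorelSpace G] [SecondCountableTopology G]
  (ρ : G →* Matrix (Fin N) (Fin N) ℂ)

/-- The crossing Boltzmann weight `E(U) = exp(β(Σ_{k=0} r_y + Σ_{k=c} r_y))`. -/
def crossE (i j : Fin 2) (β : ℝ) (U : GaugeConfig 2 L G) : ℝ :=
  Real.exp (β * (∑ y ∈ S0 i j, rr ρ i j U y + ∑ y ∈ Sc i j, rr ρ i j U y))

omit [TopologicalSpace G] [IsTopologicalGroup G] [CompactSpace G] [MeasurableSpace G] [BorelSpace G]
  [SecondCountableTopology G] in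
/-- `Ψ₂` fixes the crossing weight (`L ≥ 6` even). -/
theorem crossE_untwist' (hL : Even L) (h6 : 6 ≤ L) {i j : Fin 2} (hij : i ≠ j) (β : ℝ)
    (U : GaugeConfig 2 L G) : crossE ρ i j β (untwist' i j U) = crossE ρ i j β U := by
  have h4 : 4 ≤ L := by omega
  have h0 : ∑ y ∈ S0 i j, rr ρ i j (untwist' i j U) y = ∑ y ∈ S0 i j, rr ρ i j U y :=
    Finset.sum_congr rfl fun y hy => dependsOn_blk i j y (fun c d => ((ρ (c * d⁻¹)).trace).re)
      fun e he => untwist'_apply_of_mem_blk_S0 hL h6 hij U hy (Finset.mem_coe.1 he)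
  have hc : ∑ y ∈ Sc i j, rr ρ i j (untwist' i j U) y = ∑ y ∈ Sc i j, rr ρ i j U y :=
    Finset.sum_congr rfl fun y hy => dependsOn_blk i j y (fun c d => ((ρ (c * d⁻¹)).trace).re)
      fun e he => untwist'_apply_of_mem_blk_Sc hL h4 hij U hy (Finset.mem_coe.1 he)
  rw [crossE, crossE, h0, hc]

/-- The integrand `Φ(U) = g(U) conj g(ΘU) E(U)` of the (untwisted) target. -/
def rpPhi (i j : Fin 2) (β : ℝ) (F : GaugeConfig 2 L G → ℂ) (U : GaugeConfig 2 L G) : ℂ :=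
  gObs ρ i j β F U * (starRingEnd ℂ) (gObs ρ i j β F (configDiagSwap i j U)) * (crossE ρ i j β U : ℂ)

omit [CompactSpace G] in
/-- `Φ` is measurable. -/
theorem measurable_rpPhi (i j : Fin 2) (hρ : Continuous ρ) (β : ℝ) {F : GaugeConfig 2 L G → ℂ}
    (hF : Measurable F) : Measurable (rpPhi ρ i j β F) := by
  have hg := measurable_gObs ρ i j hρ β hF
  have hΘ : Measurable (configDiagSwap (G := G) (L := L) i j) :=
    measurable_pi_lambda _ fun e => measurable_pi_apply _
  have hsum : ∀ S : Finset (Site 2 L), Measurable fun U : GaugeConfig 2 L G => ∑ y ∈ S, rr ρ i j U y :=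
    fun S => Finset.measurable_sum _ fun y _ => measurable_rr ρ hρ i j y
  exact (hg.mul (Complex.continuous_conj.measurable.comp (hg.comp hΘ))).mul
    (Complex.measurable_ofReal.comp ((((hsum _).add (hsum _)).const_mul β).exp))

/-- **Removing the twist**: `∫ g conj(g∘Θ') exp(Σ a conj(a∘Θ')) = ∫ g conj(g∘Θ) E` for
gauge-invariant `F` (`L ≥ 6` even, `β ≥ 0`). -/
theorem integral_twisted_eq (hL : Even L) (h6 : 6 ≤ L) {i j : Fin 2} (hij : i ≠ j)
    (hρ : Continuous ρ) {β : ℝ} (hβ : 0 ≤ β) {F : GaugeConfig 2 L G → ℂ} (hF : Measurable F)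
    (hFH : IsDiagonalHalfObservable i j F) (hFg : IsGaugeInvariant F) :
    ∫ U, gObs ρ i j β F U * (starRingEnd ℂ) (gObs ρ i j β F (configTwistSwap i j U)) *
        Complex.exp (∑ ι, gcoeff ρ i j hρ β ι U *
          (starRingEnd ℂ) (gcoeff ρ i j hρ β ι (configTwistSwap i j U))) ∂(linkMeasure L G) =
      ∫ U, rpPhi ρ i j β F U ∂(linkMeasure L G) := by
  have h4 : 4 ≤ L := by omega
  have hpt : ∀ U : GaugeConfig 2 L G,
      gObs ρ i j β F U * (starRingEnd ℂ) (gObs ρ i j β F (configTwistSwap i j U)) *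
        Complex.exp (∑ ι, gcoeff ρ i j hρ β ι U *
          (starRingEnd ℂ) (gcoeff ρ i j hρ β ι (configTwistSwap i j U))) =
        rpPhi ρ i j β F (untwist' i j U) := by
    intro U
    rw [sum_gcoeff_mul_conj ρ hL h4 hij hρ hβ, ← Complex.ofReal_exp, configTwistSwap_eq,
      gObs_configTau ρ h4 hij β hFH hFg, rpPhi, crossE_untwist' ρ hL h6 hij β U, crossE,
      configDiagSwap_untwist']
    congr 2
    exact dependsOn_gObs ρ h4 hij β hFH fun e he =>
      (untwist'_apply_of_inHalf hL h4 U (mem_halfLinks.1 (Finset.mem_coe.1 he))).symm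
  have hmp : MeasurePreserving (untwist' (G := G) (L := L) i j) (linkMeasure L G) (linkMeasure L G) :=
    (measurePreserving_configDiagSwap i j).comp
      ((measurePreserving_untwist hij).comp (measurePreserving_configDiagSwap i j))
  simp_rw [hpt]
  exact LatticeRP.integral_comp_eq_of_measurePreserving hmp (measurable_rpPhi ρ i j hρ β hF)

/-- **The untwisted inequality**: `0 ≤ ∫ g(U) conj g(ΘU) E(U) dU` for gauge-invariant
closed-half observables (`L ≥ 6` even, `β ≥ 0`). -/
theorem integral_rpPhi_nonneg (hL : Even L) (h6 : 6 ≤ L) {i j : Fin 2} (hij : i ≠ j)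
    (hρ : Continuous ρ) {β : ℝ} (hβ : 0 ≤ β) {F : GaugeConfig 2 L G → ℂ} (hF : Measurable F)
    {CF : ℝ} (hFb : ∀ U, ‖F U‖ ≤ CF) (hFH : IsDiagonalHalfObservable i j F) (hFg : IsGaugeInvariant F) :
    0 ≤ ∫ U, rpPhi ρ i j β F U ∂(linkMeasure L G) := by
  rw [← integral_twisted_eq ρ hL h6 hij hρ hβ hF hFH hFg]
  exact integral_twisted_nonneg ρ hL (by omega) hij hρ β hF hFb hFH

omit [MeasurableSpace G] [BorelSpace G] [SecondCountableTopology G] in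
/-- **The pointwise factorisation of the RP integrand**:
`e^{-βS(U)} conj F(ΘU) F(U) = e^{-βN#P} Φ(U)`. -/
theorem rpIntegrand_eq (hL : Even L) (h4 : 4 ≤ L) {i j : Fin 2} (hij : i ≠ j) (hρ : Continuous ρ)
    (β : ℝ) (F : GaugeConfig 2 L G → ℂ) (U : GaugeConfig 2 L G) :
    (Real.exp (-β * wilsonAction ρ U) : ℂ) * ((starRingEnd ℂ) (F (configDiagSwap i j U)) * F U) =
      (Real.exp (-(β * (N * Fintype.card (Plaquette 2 L)))) : ℂ) * rpPhi ρ i j β F U := by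
  have hSm : ∑ y ∈ Sm i j, rr ρ i j U y = ∑ y ∈ Sp i j, rr ρ i j (configDiagSwap i j U) y := by
    rw [← sum_Sp_swap hL i j]
    exact Finset.sum_congr rfl fun y _ => (rr_configDiagSwap ρ hρ i j U y).symm
  rw [wilsonAction_eq_sum_rr ρ hρ hij, sum_split h4 i j, hSm, rpPhi, gObs, gObs, crossE]
  simp only [map_mul, Complex.conj_ofReal]
  rw [show -β * (↑N * ↑(Fintype.card (Plaquette 2 L)) -
        (∑ y ∈ S0 i j, rr ρ i j U y + ∑ y ∈ Sc i j, rr ρ i j U y + ∑ y ∈ Sp i j, rr ρ i j U y +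
          ∑ y ∈ Sp i j, rr ρ i j (configDiagSwap i j U) y)) =
      -(β * (↑N * ↑(Fintype.card (Plaquette 2 L)))) +
        β * (∑ y ∈ S0 i j, rr ρ i j U y + ∑ y ∈ Sc i j, rr ρ i j U y) +
        β * ∑ y ∈ Sp i j, rr ρ i j U y + β * ∑ y ∈ Sp i j, rr ρ i j (configDiagSwap i j U) y by ring,
    Real.exp_add, Real.exp_add, Real.exp_add]
  push_cast
  ring

/-- **L3(ε): diagonal reflection positivity HOLDS on the two-dimensional even torus for
gauge-invariant observables.** Let `L ≥ 6` be even, `G` a compact metrisable group, `ρ` a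
continuous finite-dimensional representation, `β ≥ 0`, `i ≠ j`. Then for every bounded measurable
GAUGE-INVARIANT observable `F` of the closed diagonal half `{0 ≤ (y_i - y_j) mod L ≤ L/2}`,
`0 ≤ ⟨(ΘF)‾ F⟩_{Λ,β}` (real and non-negative in `Complex.partialOrder`), `Θ` the diagonal swap. -/
theorem wilsonExpectation_swap_nonneg_of_isGaugeInvariant (hL : Even L) (h6 : 6 ≤ L)
    (hρ : Continuous ρ) {β : ℝ} (hβ : 0 ≤ β) {i j : Fin 2} (hij : i ≠ j)
    {F : GaugeConfig 2 L G → ℂ} (hF : Measurable F) (hFb : ∃ C : ℝ, ∀ U, ‖F U‖ ≤ C)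
    (hFH : IsDiagonalHalfObservable i j F) (hFg : IsGaugeInvariant F) :
    0 ≤ wilsonExpectation ρ β fun U => (starRingEnd ℂ) (F (configDiagSwap i j U)) * F U := by
  obtain ⟨CF, hFb⟩ := hFb
  have hdens : Measurable fun U : GaugeConfig 2 L G =>
      ENNReal.ofReal (Real.exp (-β * wilsonAction ρ U)) :=
    ENNReal.measurable_ofReal.comp ((WilsonRP.measurable_wilsonAction ρ hρ).const_mul (-β)).exp
  unfold wilsonExpectation wilsonMeasure
  rw [integral_smul_measure]
  unfold wilsonWeight
  rw [integral_withDensity_eq_integral_toReal_smul hdens (ae_of_all _ fun _ => ENNReal.ofReal_lt_top)]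
  simp_rw [ENNReal.toReal_ofReal (Real.exp_nonneg _), Complex.real_smul]
  refine mul_nonneg (Complex.zero_le_real.2 ENNReal.toReal_nonneg) ?_
  simp_rw [rpIntegrand_eq ρ hL (by omega) hij hρ β F]
  rw [integral_const_mul]
  exact mul_nonneg (Complex.zero_le_real.2 (Real.exp_pos _).le)
    (integral_rpPhi_nonneg ρ hL h6 hij hρ hβ hF hFb hFH hFg)

/-- **L3(ε), packaged**: `GaugeInvariantDiagonalRP ρ β i j` holds on `(ℤ/L)²`, `L ≥ 6` even,
`β ≥ 0` (contrast `not_diagonalReflectionPositive_two`: the unrestricted statement fails for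
`β ≠ 0`). -/
theorem gaugeInvariantDiagonalRP_two (hL : Even L) (h6 : 6 ≤ L) (hρ : Continuous ρ) {β : ℝ}
    (hβ : 0 ≤ β) {i j : Fin 2} (hij : i ≠ j) :
    GaugeInvariantDiagonalRP (d := 2) (L := L) ρ β i j :=
  fun _ hF hFb hFH hFg => wilsonExpectation_swap_nonneg_of_isGaugeInvariant ρ hL h6 hρ hβ hij hF hFb hFH hFg

end Main

end DiagRPTwo

end

end Summit.QuantumFields.GaugeBoot
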